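import Literature.MathematicalPhysics.QuantumLattice.HubbardInteractionClassDecaySharp
import Literature.MathematicalPhysics.QuantumLattice.HubbardRingSpinDecaySharp
import HarnessLib

/-!
# Koma–Tasaki decay of the TRANSVERSE SPIN correlation for the interaction class
# `H(t,U) - μN + V({n_{x,σ}})`, `V` an arbitrary real function of the number operators

Trunk T-QLATTICE (family `hubbard`; companion of `HubbardInteractionClassDecaySharp.lean` (charge
sector: `n`-fermion products, site gauge) and of `HubbardSignGaugeBoundSharp.lean` /
`HubbardRingSpinDecaySharp.lean` (transverse spin correlation of the PURE model)).

Koma–Tasaki, PRL 68 (1992) 3248, eq. (1) and the last paragraph of the proof: the magnetic bound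
`|⟨S⁺_x S⁻_y⟩| ≤ …` is obtained from the spin-dependent ("sign") gauge
`θ_{x↑} = -θ_{x↓} = iψ_x`, i.e. the orbital gauge `exp[Σ_{(u,σ)} ε_σ ψ_u n_{uσ}]`, `ε = (-1,+1)`.
That gauge is again a function of the number operators `n_{uσ}`, so it commutes with every
interaction `V({n_{x,σ}})` of their eq. (1) — in the occupation basis, every real diagonal matrix
`densityInteraction W` (density–density interactions of any range and sign, random potentials,
and — new compared with the charge sector — arbitrary, e.g. random or staggered, LONGITUDINAL
magnetic fields `Σ_u h_u S^z_u`). Hence (this file):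

* `gaugeProd_mul_densityInteraction_mul` — every orbital gauge `diag(∏ e^{v_i})` fixes `V({n})`;
* `gauge_hermitianPart_sub_hamiltonianWith_add_signWeights` (+ `norm_…_le`) — the Hermitian part
  of the sign-gauge transform of `H(t,U) - μN + V` minus `H(t,U) - μN + V` is the SAME operator
  `-t·T(cosh(ψ_u-ψ_v)-1)` as for the pure model (eqs. (7), (9), (11));
* `norm_trace_mul_gibbsWeight_hamiltonianWith_add_le_signWeights`,
  `norm_gibbsState_hubbardTorusWith_add_le_signWeights` — the trace / Gibbs-state bounds with the
  printed constant, for the class;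
* `norm_thermalCorr_siteSpinPlus_densityInteraction_le_sharp` — the a priori bound
  `|⟨S⁺_x S⁻_y⟩_{β; H+V}| ≤ e^{-2(ψ_x-ψ_y)} exp[β|t| ΣΣ(cosh(ψ_u-ψ_{u'})-1)]`, any `d`, uniformly in `V`;
* consequences with constants INDEPENDENT of `V`: on the ring, `norm_thermalCorr_siteSpinPlus_ring_
  densityInteraction_le_exp` (free `q`), `…_lowT` (`ξ_spin ≤ 4|t|/T` for `T ≤ 4|t|`), `…_highT`
  (rate `≥ 1`); on `(ℤ/Lℤ)²`, `norm_thermalCorr_siteSpinPlus_densityInteraction_le_rpow_euclid`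
  (the sharp power law, exponent `4q - 4πβ|t|q²`, i.e. `η_spin(T) ≥ T/(π|t|)` at `q = 1/(2πβ|t|)`).

NOT covered: perturbations that do not commute with the `n_{uσ}` (transverse fields, exchange
couplings `S_u·S_v` — they commute with the local CHARGES and are covered by the charge-sector
companion, but not with the spin-resolved densities; charge-moving terms); `T = 0`.

References: T. Koma, H. Tasaki, PRL 68 (1992) 3248 (eq. (1); eqs. (5)–(13); the last paragraph
of the proof); O. McBryan, T. Spencer, CMP 53 (1977) 299.
-/

noncomputable section

namespace Literature.MathematicalPhysics.QuantumLattice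

open Matrix Finset NormedSpace Literature.Probability.LatticeModels
  Literature.Barriers.HubbardSuperconductivity
open scoped Matrix.Norms.L2Operator ComplexOrder

/-! ### Sign gauges and the interaction class on a finite graph -/

section SignGaugeClass

variable {Λ : Type*} [LinearOrder Λ] [Fintype Λ] (G : SimpleGraph Λ) [DecidableRel G.Adj]

/-- **Eq. (7), orbital form**: every orbital gauge `diag(∏_{i∈s} e^{v_i})` (in particular the
spin-dependent sign gauge of the magnetic case) is a function of the number operators and
therefore fixes `V({n_{x,σ}})`: `D_v V D_{-v} = V`. Koma–Tasaki, PRL 68 (1992) 3248, eq. (7) and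
the last paragraph of the proof. [cite: KomaTasakiPRL1992, eq. (7)] -/
theorem gaugeProd_mul_densityInteraction_mul (v : Orb Λ → ℝ) (W : Finset (Orb Λ) → ℝ) :
    diagonal (fun s : Finset (Orb Λ) => ∏ i ∈ s, (Real.exp (v i) : ℂ)) * densityInteraction W *
        diagonal (fun s : Finset (Orb Λ) => ∏ i ∈ s, (Real.exp (-v i) : ℂ)) =
      densityInteraction W := by
  unfold densityInteraction
  rw [diagonal_mul_diagonal, diagonal_mul_diagonal]
  congr 1
  funext s
  have h1 : (∏ i ∈ s, (Real.exp (v i) : ℂ)) * (∏ i ∈ s, (Real.exp (-v i) : ℂ)) = 1 := by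
    rw [← prod_mul_distrib]
    refine prod_eq_one fun i _ => ?_
    rw [← Complex.ofReal_mul, ← Real.exp_add, add_neg_cancel, Real.exp_zero, Complex.ofReal_one]
  calc (∏ i ∈ s, (Real.exp (v i) : ℂ)) * ((W s : ℝ) : ℂ) * ∏ i ∈ s, (Real.exp (-v i) : ℂ)
      = ((W s : ℝ) : ℂ) * ((∏ i ∈ s, (Real.exp (v i) : ℂ)) * ∏ i ∈ s, (Real.exp (-v i) : ℂ)) := by
        ring
    _ = ((W s : ℝ) : ℂ) := by rw [h1, mul_one]

/-- **The Hermitian part of the sign-gauge transform of `H(t,U) - μN + V({n})`** (Koma–Tasaki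
eqs. (7), (9), class version): `(H' + H'ᴴ)/2 - (H - μN + V) = -t · T(cosh(ψ_u - ψ_v) - 1)` — the
same operator as for the pure model, for every sign pattern and every `V`. Koma–Tasaki, PRL 68
(1992) 3248, eqs. (1), (7), (9). [cite: KomaTasakiPRL1992, eqs. (7) and (9)] -/
theorem gauge_hermitianPart_sub_hamiltonianWith_add_signWeights (ε : Fin 2 → ℝ)
    (hε : ∀ σ, ε σ = 1 ∨ ε σ = -1) (ψ : Λ → ℝ) (t U μ : ℝ) (W : Finset (Orb Λ) → ℝ) :
    (2 : ℂ)⁻¹ • ((diagonal (fun s : Finset (Orb Λ) =>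
        ∏ i ∈ s, (Real.exp (signWeights ε ψ i) : ℂ)) *
        (hamiltonianWith G t U μ + densityInteraction W) *
        diagonal (fun s : Finset (Orb Λ) => ∏ i ∈ s, (Real.exp (-signWeights ε ψ i) : ℂ))) +
      (diagonal (fun s : Finset (Orb Λ) =>
        ∏ i ∈ s, (Real.exp (signWeights ε ψ i) : ℂ)) *
        (hamiltonianWith G t U μ + densityInteraction W) *
        diagonal (fun s : Finset (Orb Λ) => ∏ i ∈ s, (Real.exp (-signWeights ε ψ i) : ℂ)))ᴴ) -
      (hamiltonianWith G t U μ + densityInteraction W) =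
    -(t : ℂ) • hoppingForm G (fun u v => Real.cosh (ψ u - ψ v) - 1) := by
  set Dp : Matrix (Finset (Orb Λ)) (Finset (Orb Λ)) ℂ :=
    diagonal (fun s : Finset (Orb Λ) => ∏ i ∈ s, (Real.exp (signWeights ε ψ i) : ℂ)) with hDp
  set Dm : Matrix (Finset (Orb Λ)) (Finset (Orb Λ)) ℂ :=
    diagonal (fun s : Finset (Orb Λ) => ∏ i ∈ s, (Real.exp (-signWeights ε ψ i) : ℂ)) with hDm
  set H : Matrix (Finset (Orb Λ)) (Finset (Orb Λ)) ℂ := hamiltonianWith G t U μ with hH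
  set V : Matrix (Finset (Orb Λ)) (Finset (Orb Λ)) ℂ := densityInteraction W with hV
  have hVD : Dp * V * Dm = V := gaugeProd_mul_densityInteraction_mul (signWeights ε ψ) W
  have hVh : Vᴴ = V := (isHermitian_densityInteraction W).eq
  rw [Matrix.mul_add, Matrix.add_mul, hVD, conjTranspose_add, hVh]
  have hre : (2 : ℂ)⁻¹ • (Dp * H * Dm + V + ((Dp * H * Dm)ᴴ + V)) - (H + V) =
      (2 : ℂ)⁻¹ • (Dp * H * Dm + (Dp * H * Dm)ᴴ) - H := by
    have h2 : Dp * H * Dm + V + ((Dp * H * Dm)ᴴ + V) =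
        (Dp * H * Dm + (Dp * H * Dm)ᴴ) + (2 : ℂ) • V := by
      rw [two_smul]; abel
    rw [h2, smul_add, smul_smul, inv_mul_cancel₀ (by norm_num : (2 : ℂ) ≠ 0), one_smul]
    abel
  rw [hre]
  exact gauge_hermitianPart_sub_hamiltonianWith_signWeights G ε hε ψ t U μ

/-- **Koma–Tasaki's eq. (11) as printed, sign gauge, class version**: the Hermitian part `U` of
the gauge-transformed `H(t,U) - μN + V({n})` minus `H(t,U) - μN + V({n})` obeys
`‖U‖ ≤ |t| Σ_u Σ_v [u ∼ v] (cosh(ψ_u - ψ_v) - 1)`, independently of `V`.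
Koma–Tasaki, PRL 68 (1992) 3248, eq. (11). [cite: KomaTasakiPRL1992, eq. (11), first inequality] -/
theorem norm_gauge_hermitianPart_sub_hamiltonianWith_add_signWeights_le (ε : Fin 2 → ℝ)
    (hε : ∀ σ, ε σ = 1 ∨ ε σ = -1) (ψ : Λ → ℝ) (t U μ : ℝ) (W : Finset (Orb Λ) → ℝ) :
    ‖(2 : ℂ)⁻¹ • ((diagonal (fun s : Finset (Orb Λ) =>
        ∏ i ∈ s, (Real.exp (signWeights ε ψ i) : ℂ)) *
        (hamiltonianWith G t U μ + densityInteraction W) *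
        diagonal (fun s : Finset (Orb Λ) => ∏ i ∈ s, (Real.exp (-signWeights ε ψ i) : ℂ))) +
      (diagonal (fun s : Finset (Orb Λ) =>
        ∏ i ∈ s, (Real.exp (signWeights ε ψ i) : ℂ)) *
        (hamiltonianWith G t U μ + densityInteraction W) *
        diagonal (fun s : Finset (Orb Λ) => ∏ i ∈ s, (Real.exp (-signWeights ε ψ i) : ℂ)))ᴴ) -
      (hamiltonianWith G t U μ + densityInteraction W)‖ ≤
    |t| * ∑ u : Λ, ∑ v : Λ, if G.Adj u v then (Real.cosh (ψ u - ψ v) - 1) else 0 := by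
  rw [gauge_hermitianPart_sub_hamiltonianWith_add_signWeights G ε hε ψ t U μ W]
  exact norm_hoppingPerturbation_le_sharp G ψ t

/-- **Koma–Tasaki bound for the Gibbs weight of `H(t,U) - μN + V({n})`, sign gauge, printed
constant** (fermionic form of eqs. (6), (10), (11) for the class): for any finite graph, a sign
gauge `v = ε ⊗ ψ`, `β ≥ 0`, every `V = densityInteraction W`, and an observable `A` with
`G_{e^v} A G_{e^v}⁻¹ = κ A`,
`|Tr (A e^{-β(H - μN + V)})| ≤ |κ| ‖A‖ exp [β |t| Σ_u Σ_v [u∼v] (cosh (ψ_u - ψ_v) - 1)] Tr e^{-β(H - μN + V)}`.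
Koma–Tasaki, PRL 68 (1992) 3248, eqs. (1), (6), (10), (11). [cite: KomaTasakiPRL1992, eqs. (6)–(11)] -/
theorem norm_trace_mul_gibbsWeight_hamiltonianWith_add_le_signWeights (ε : Fin 2 → ℝ)
    (hε : ∀ σ, ε σ = 1 ∨ ε σ = -1) (ψ : Λ → ℝ) (t U μ β : ℝ) (hβ : 0 ≤ β)
    (W : Finset (Orb Λ) → ℝ)
    (A : Matrix (Finset (Orb Λ)) (Finset (Orb Λ)) ℂ) (κ : ℂ)
    (hA : diagonal (fun s : Finset (Orb Λ) => ∏ i ∈ s, (Real.exp (signWeights ε ψ i) : ℂ)) *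
        A * diagonal (fun s : Finset (Orb Λ) =>
          ∏ i ∈ s, (Real.exp (-signWeights ε ψ i) : ℂ)) = κ • A) :
    ‖(A * exp (-(β : ℂ) • (hamiltonianWith G t U μ + densityInteraction W))).trace‖ ≤
      ‖κ‖ * ‖A‖ * Real.exp (β * (|t| * ∑ u : Λ, ∑ v : Λ, if G.Adj u v then
        (Real.cosh (ψ u - ψ v) - 1) else 0)) *
        ((exp (-(β : ℂ) • (hamiltonianWith G t U μ + densityInteraction W))).trace).re := by
  set v : Orb Λ → ℝ := signWeights ε ψ with hv
  set Wp : Matrix (Finset (Orb Λ)) (Finset (Orb Λ)) ℂ :=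
    diagonal (fun s : Finset (Orb Λ) => ∏ i ∈ s, (Real.exp (v i) : ℂ)) with hWp
  set Wm : Matrix (Finset (Orb Λ)) (Finset (Orb Λ)) ℂ :=
    diagonal (fun s : Finset (Orb Λ) => ∏ i ∈ s, (Real.exp (-v i) : ℂ)) with hWm
  have h1 : Wp * Wm = 1 := diagonal_prod_exp_mul_diagonal_prod_exp_neg v
  have h2 : Wm * Wp = 1 := diagonal_prod_exp_neg_mul_diagonal_prod_exp v
  let Gu : (Matrix (Finset (Orb Λ)) (Finset (Orb Λ)) ℂ)ˣ := ⟨Wp, Wm, h1, h2⟩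
  set H : Matrix (Finset (Orb Λ)) (Finset (Orb Λ)) ℂ :=
    hamiltonianWith G t U μ + densityInteraction W with hH
  have hHh : H.IsHermitian := isHermitian_hamiltonianWith_add G t U μ (isHermitian_densityInteraction W)
  have hβH : ((β : ℂ) • H).IsHermitian := isHermitian_real_smul hHh β
  have key := koma_tasaki_trace_bound hβH Gu A κ hA
  have hneg : -((β : ℂ) • H) = -(β : ℂ) • H := (neg_smul _ _).symm
  rw [hneg] at key
  refine key.trans ?_
  have hUn : ‖(2 : ℂ)⁻¹ • ((Gu : Matrix _ _ ℂ) * ((β : ℂ) • H) *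
      ((Gu⁻¹ : (Matrix _ _ ℂ)ˣ) : Matrix _ _ ℂ) +
      ((Gu : Matrix _ _ ℂ) * ((β : ℂ) • H) * ((Gu⁻¹ : (Matrix _ _ ℂ)ˣ) : Matrix _ _ ℂ))ᴴ) -
        (β : ℂ) • H‖ ≤
      β * (|t| * ∑ u : Λ, ∑ v : Λ, if G.Adj u v then
        (Real.cosh (ψ u - ψ v) - 1) else 0) := by
    have hGu : (Gu : Matrix _ _ ℂ) = Wp := rfl
    have hGu' : ((Gu⁻¹ : (Matrix _ _ ℂ)ˣ) : Matrix _ _ ℂ) = Wm := rfl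
    rw [hGu, hGu']
    have hs : star (β : ℂ) = β := by simp
    have hcalc : (2 : ℂ)⁻¹ • (Wp * ((β : ℂ) • H) * Wm + (Wp * ((β : ℂ) • H) * Wm)ᴴ) - (β : ℂ) • H =
        (β : ℂ) • ((2 : ℂ)⁻¹ • (Wp * H * Wm + (Wp * H * Wm)ᴴ) - H) := by
      rw [Matrix.mul_smul, Matrix.smul_mul, conjTranspose_smul, hs, ← smul_add, smul_comm,
        ← smul_sub]
    rw [hcalc, norm_smul, Complex.norm_real, Real.norm_eq_abs, abs_of_nonneg hβ]
    exact mul_le_mul_of_nonneg_left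
      (norm_gauge_hermitianPart_sub_hamiltonianWith_add_signWeights_le G ε hε ψ t U μ W) hβ
  have htr : 0 ≤ ((exp (-(β : ℂ) • H)).trace).re := by
    rw [← hneg, Complex.re_eq_norm.mpr (posSemidef_exp_of_isHermitian hβH.neg).trace_nonneg]
    exact norm_nonneg _
  gcongr

end SignGaugeClass

/-! ### The torus: Gibbs state and the transverse spin correlation, uniformly over the class -/

section TorusClass

variable {d L : ℕ} [NeZero L]

/-- The bond sum of a site function lifted to the fermionic torus equals the bond sum on
`(ℤ/Lℤ)^d`. [folklore] -/
private theorem sum_sum_fermionTorusGraph_cosh_eqS (ψ : TorusSite d L → ℝ) :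
    (∑ u : FermionTorus d L, ∑ v : FermionTorus d L,
      if (fermionTorusGraph d L).Adj u v then
        (Real.cosh (ψ (FermionTorus.toTorusSite u) - ψ (FermionTorus.toTorusSite v)) - 1)
      else 0) =
      ∑ a : TorusSite d L, ∑ b : TorusSite d L,
        if (torusGraph d L).Adj a b then (Real.cosh (ψ a - ψ b) - 1) else 0 := by
  refine Fintype.sum_equiv FermionTorus.equivTorusSite _ _ fun u => ?_
  refine Fintype.sum_equiv FermionTorus.equivTorusSite _ _ fun v => ?_
  simp [FermionTorus.equivTorusSite]

/-- **Koma–Tasaki bound for the torus Gibbs state of `H(t,U) - μN + V({n})`, sign-gauge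
eigen-operator, printed constant**: for a sign pattern `ε_σ = ±1`, a real `ψ` on `(ℤ/Lℤ)^d`,
`β ≥ 0`, every `V = densityInteraction W`, and `A` with `‖A‖ ≤ 1`, `G_{e^v} A G_{e^v}⁻¹ = κ A`:
`|⟨A⟩_{β,L; H+V}| ≤ |κ| exp [β |t| Σ_u Σ_{u'} [u ∼ u'] (cosh (ψ_u - ψ_{u'}) - 1)]`, uniformly in `V`.
Koma–Tasaki, PRL 68 (1992) 3248, eqs. (1), (6)–(12). [cite: KomaTasakiPRL1992, eqs. (6)–(12)] -/
theorem norm_gibbsState_hubbardTorusWith_add_le_signWeights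
    [instDE : DecidableEq (FermionTorus d L)]
    (t U μ β : ℝ) (hβ : 0 ≤ β) (ε : Fin 2 → ℝ) (hε : ∀ σ, ε σ = 1 ∨ ε σ = -1)
    (ψ : TorusSite d L → ℝ) (W : Finset (Orb (FermionTorus d L)) → ℝ)
    (A : Matrix (Finset (Orb (FermionTorus d L))) (Finset (Orb (FermionTorus d L))) ℂ) (κ : ℂ)
    (hA : diagonal (fun s : Finset (Orb (FermionTorus d L)) => ∏ i ∈ s,
          (Real.exp (signWeights ε (fun u => ψ (FermionTorus.toTorusSite u)) i) : ℂ)) * A *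
        diagonal (fun s : Finset (Orb (FermionTorus d L)) => ∏ i ∈ s,
          (Real.exp (-signWeights ε (fun u => ψ (FermionTorus.toTorusSite u)) i) : ℂ)) =
        κ • A)
    (hAn : ‖A‖ ≤ 1) :
    ‖gibbsState β (hubbardTorusWith d L t U μ + densityInteraction W) A‖ ≤
      ‖κ‖ * Real.exp (β * (|t| * ∑ u, ∑ u',
        (if (torusGraph d L).Adj u u' then Real.cosh (ψ u - ψ u') - 1 else 0))) := by
  obtain rfl : instDE = LinearOrder.toDecidableEq := Subsingleton.elim _ _
  letI instDE : DecidableEq (FermionTorus d L) := LinearOrder.toDecidableEq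
  have key := norm_trace_mul_gibbsWeight_hamiltonianWith_add_le_signWeights (fermionTorusGraph d L)
    ε hε (fun u => ψ (FermionTorus.toTorusSite u)) t U μ β hβ W A κ hA
  rw [sum_sum_fermionTorusGraph_cosh_eqS ψ] at key
  have hH : (hubbardTorusWith d L t U μ + densityInteraction W).IsHermitian :=
    isHermitian_hamiltonianWith_add _ t U μ (isHermitian_densityInteraction W)
  refine norm_gibbsState_le_of_trace_bound hH β A (key.trans ?_)
  have htr : 0 ≤ ((exp (-(β : ℂ) •
      (hamiltonianWith (fermionTorusGraph d L) t U μ + densityInteraction W))).trace).re := by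
    have hβH : (-(β : ℂ) •
        (hamiltonianWith (fermionTorusGraph d L) t U μ + densityInteraction W)).IsHermitian := by
      have hH' : (hamiltonianWith (fermionTorusGraph d L) t U μ +
          densityInteraction W).IsHermitian := hH
      have := isHermitian_real_smul hH' (-β)
      simpa using this
    rw [Complex.re_eq_norm.mpr (posSemidef_exp_of_isHermitian hβH).trace_nonneg]
    exact norm_nonneg _
  calc _ ≤ ‖κ‖ * 1 * Real.exp (β * (|t| * ∑ u, ∑ u',
        (if (torusGraph d L).Adj u u' then Real.cosh (ψ u - ψ u') - 1 else 0))) *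
        ((exp (-(β : ℂ) •
          (hamiltonianWith (fermionTorusGraph d L) t U μ + densityInteraction W))).trace).re := by
        gcongr
    _ = _ := by rw [mul_one]; rfl

/-- **Koma–Tasaki's a priori bound for the transverse spin correlation, printed constant, for
the whole class `H(t,U) - μN + V({n_{x,σ}})`**: for every real `ψ` on `(ℤ/Lℤ)^d`, `β ≥ 0`, all
`t, U, μ` and EVERY real `W`,
`|⟨S⁺_x S⁻_y⟩_{β,L; H+V}| ≤ e^{-2(ψ_x - ψ_y)} exp [β |t| Σ_u Σ_{u'} [u ∼ u'] (cosh (ψ_u - ψ_{u'}) - 1)]`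
— the right-hand side does not depend on `V`, `U`, `μ`. Koma–Tasaki, PRL 68 (1992) 3248, eq. (1),
eqs. (6)–(12) and the last paragraph of the proof. [cite: KomaTasakiPRL1992, eq. (12), magnetic case] -/
theorem norm_thermalCorr_siteSpinPlus_densityInteraction_le_sharp
    [instDE : DecidableEq (FermionTorus d L)]
    (t U μ β : ℝ) (hβ : 0 ≤ β) (W : Finset (Orb (FermionTorus d L)) → ℝ)
    (ψ : TorusSite d L → ℝ) (x y : TorusSite d L) :
    ‖(hubbardTorusWith d L t U μ + densityInteraction W).thermalCorr β
        (siteSpinPlus x) (siteSpinPlus y)ᴴ‖ ≤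
      Real.exp (-(2 * (ψ x - ψ y))) * Real.exp (β * (|t| *
        ∑ u, ∑ u', (if (torusGraph d L).Adj u u' then Real.cosh (ψ u - ψ u') - 1 else 0))) := by
  obtain rfl : instDE = LinearOrder.toDecidableEq := Subsingleton.elim _ _
  letI instDE : DecidableEq (FermionTorus d L) := LinearOrder.toDecidableEq
  -- the spin-dependent sign pattern `ε = (-1, +1)`
  let ε : Fin 2 → ℝ := fun σ => if σ = 0 then -1 else 1
  have hε : ∀ σ, ε σ = 1 ∨ ε σ = -1 := fun σ => by
    simp only [ε]; split_ifs <;> simp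
  set v : Orb (FermionTorus d L) → ℝ :=
    signWeights ε (fun u => ψ (FermionTorus.toTorusSite u)) with hvdef
  have hv0 : ∀ z : FermionTorus d L, v (orb z 0) = -ψ (FermionTorus.toTorusSite z) := by
    intro z; rw [hvdef]; simp [signWeights, orb, ε]
  have hv1 : ∀ z : FermionTorus d L, v (orb z 1) = ψ (FermionTorus.toTorusSite z) := by
    intro z; rw [hvdef]; simp [signWeights, orb, ε]
  let X := FermionTorus.ofTorusSite x
  let Y := FermionTorus.ofTorusSite y
  let P : Matrix (Finset (Orb (FermionTorus d L))) (Finset (Orb (FermionTorus d L))) ℂ :=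
    creation (orb X 0) * annihilation (orb X 1)
  let Q : Matrix (Finset (Orb (FermionTorus d L))) (Finset (Orb (FermionTorus d L))) ℂ :=
    creation (orb Y 1) * annihilation (orb Y 0)
  have hAeq : siteSpinPlus x * (siteSpinPlus y)ᴴ = P * Q := siteSpinPlus_mul_conjTranspose x y
  have hWA := gauge_conj_mul v (gauge_conj_creation_mul_annihilation v (orb X 0) (orb X 1))
    (gauge_conj_creation_mul_annihilation v (orb Y 1) (orb Y 0))
  have hκn : ‖(Real.exp (v (orb X 0) - v (orb X 1)) : ℂ) *
      (Real.exp (v (orb Y 1) - v (orb Y 0)) : ℂ)‖ = Real.exp (-(2 * (ψ x - ψ y))) := by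
    rw [norm_mul, Complex.norm_real, Complex.norm_real, Real.norm_eq_abs, Real.norm_eq_abs,
      abs_of_pos (Real.exp_pos _), abs_of_pos (Real.exp_pos _), ← Real.exp_add, hv0, hv1, hv0, hv1]
    simp only [X, Y, FermionTorus.toTorusSite_ofTorusSite]
    ring_nf
  have hAn : ‖P * Q‖ ≤ 1 := by
    calc ‖P * Q‖ ≤ ‖P‖ * ‖Q‖ := l2_opNorm_mul _ _
      _ ≤ 1 * 1 := mul_le_mul (l2_opNorm_creation_mul_annihilation_le_one _ _)
          (l2_opNorm_creation_mul_annihilation_le_one _ _) (norm_nonneg _) zero_le_one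
      _ = 1 := one_mul 1
  have core := norm_gibbsState_hubbardTorusWith_add_le_signWeights t U μ β hβ ε hε ψ W (P * Q) _
    hWA hAn
  rw [hκn] at core
  rw [Matrix.thermalCorr, hAeq]
  exact core

/-- With `ψ = 0`: `|⟨S⁺_x S⁻_y⟩_{β,L; H+V}| ≤ 1` for the whole class. [cite: KomaTasakiPRL1992, eq. (12)] -/
theorem norm_thermalCorr_siteSpinPlus_densityInteraction_le_one (t U μ β : ℝ) (hβ : 0 ≤ β)
    (W : Finset (Orb (FermionTorus d L)) → ℝ) (x y : TorusSite d L) :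
    ‖(hubbardTorusWith d L t U μ + densityInteraction W).thermalCorr β
        (siteSpinPlus x) (siteSpinPlus y)ᴴ‖ ≤ 1 := by
  have h := norm_thermalCorr_siteSpinPlus_densityInteraction_le_sharp t U μ β hβ W
    (fun _ => (0 : ℝ)) x y
  simp only [sub_self, mul_zero, neg_zero, Real.cosh_zero, ite_self, sum_const_zero,
    Real.exp_zero, mul_one] at h
  exact h

end TorusClass

/-! ### The ring: explicit transverse spin correlation lengths, uniformly over the class -/

section RingClass

/-- **One dimension, transverse spin correlation of `H(t,U) - μN + V({n})`, explicit rate**: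
on the ring `ℤ/Lℤ`, for every real `W`, all real `t, U, μ`, `β ≥ 0`, `q ≥ 0` and sites `x, y`,
`|⟨S⁺_x S⁻_y⟩_{β,L; H+V}| ≤ e^{4q} exp(-[2q - 4β|t|(cosh q - 1)] dist(x,y))` — the bound of
`norm_thermalCorr_siteSpinPlus_ring_le_exp` verbatim (clamped-cone profile via the
model-independent `le_exp_ring_of_apriori_flat`). Koma–Tasaki, PRL 68 (1992) 3248, eq. (1) and
Theorem eq. (4), one-dimensional clause. [cite: KomaTasakiPRL1992, Theorem eq. (4) (one-dimensional clause)] -/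
theorem norm_thermalCorr_siteSpinPlus_ring_densityInteraction_le_exp (L : ℕ) [NeZero L]
    (t U μ β q : ℝ) (hβ : 0 ≤ β) (hq : 0 ≤ q) (W : Finset (Orb (FermionTorus 1 L)) → ℝ)
    (x y : TorusSite 1 L) :
    ‖(hubbardTorusWith 1 L t U μ + densityInteraction W).thermalCorr β
        (siteSpinPlus x) (siteSpinPlus y)ᴴ‖ ≤
      Real.exp (4 * q) *
        Real.exp (-((2 * q - 4 * (β * |t|) * (Real.cosh q - 1)) * (torusDist x y : ℝ))) := by
  have h := le_exp_ring_of_apriori_flat L (β * |t|) 2 q _ (mul_nonneg hβ (abs_nonneg t))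
    (by norm_num) hq x y
    (fun φ _ _ => (norm_thermalCorr_siteSpinPlus_densityInteraction_le_sharp t U μ β hβ W φ
      x y).trans_eq (by rw [mul_assoc]))
  calc _ ≤ _ := h
    _ = _ := by norm_num

/-- **Low temperatures, class version: `ξ_spin ≤ 4|t|/T`**: if `1 ≤ 4β|t|` then for every real
`W`, `|⟨S⁺_x S⁻_y⟩_{β,L; H+V}| ≤ e^{1/(β|t|)} exp(-dist(x,y)/(4β|t|))`, uniformly in `L`, `U`, `μ`
and `V`. [cite: KomaTasakiPRL1992, Theorem eq. (4) (one-dimensional clause) and p. 3249] -/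
theorem norm_thermalCorr_siteSpinPlus_ring_densityInteraction_le_exp_lowT (L : ℕ) [NeZero L]
    (t U μ β : ℝ) (hβ : 0 ≤ β) (hT : 1 ≤ 4 * (β * |t|))
    (W : Finset (Orb (FermionTorus 1 L)) → ℝ) (x y : TorusSite 1 L) :
    ‖(hubbardTorusWith 1 L t U μ + densityInteraction W).thermalCorr β
        (siteSpinPlus x) (siteSpinPlus y)ᴴ‖ ≤
      Real.exp (1 / (β * |t|)) * Real.exp (-(1 / (4 * (β * |t|)) * (torusDist x y : ℝ))) := by
  set b : ℝ := β * |t| with hb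
  have hbpos : 0 < b := by linarith
  set q : ℝ := 1 / (4 * b) with hq
  have hq0 : 0 ≤ q := by positivity
  have hq1 : q ≤ 1 := by
    rw [hq, div_le_one (by positivity)]
    linarith
  have h := norm_thermalCorr_siteSpinPlus_ring_densityInteraction_le_exp L t U μ β q hβ hq0 W x y
  have hcosh : Real.cosh q - 1 ≤ q ^ 2 :=
    cosh_sub_one_le_sq (s := q) (by rw [abs_of_nonneg hq0]; exact hq1)
  have h4q : 4 * q = 1 / b := by rw [hq]; field_simp
  have hm : 1 / (4 * b) ≤ 2 * q - 4 * b * (Real.cosh q - 1) := by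
    have h4b : 4 * b * (Real.cosh q - 1) ≤ 4 * b * q ^ 2 :=
      mul_le_mul_of_nonneg_left hcosh (by positivity)
    have hval : 2 * q - 4 * b * q ^ 2 = 1 / (4 * b) := by
      rw [hq]; field_simp; ring
    linarith
  refine h.trans ?_
  rw [h4q]
  refine mul_le_mul_of_nonneg_left (Real.exp_le_exp.2 ?_) (Real.exp_pos _).le
  have hr0 : (0 : ℝ) ≤ torusDist x y := Nat.cast_nonneg _
  nlinarith

/-- **High temperatures, class version** (`4β|t| ≤ 1`): for every real `W`,
`|⟨S⁺_x S⁻_y⟩_{β,L; H+V}| ≤ e^4 exp(-dist(x,y))`, uniformly in `L`, `U`, `μ` and `V`.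
[cite: KomaTasakiPRL1992, Theorem eq. (4) (one-dimensional clause) and p. 3249] -/
theorem norm_thermalCorr_siteSpinPlus_ring_densityInteraction_le_exp_highT (L : ℕ) [NeZero L]
    (t U μ β : ℝ) (hβ : 0 ≤ β) (hT : 4 * (β * |t|) ≤ 1)
    (W : Finset (Orb (FermionTorus 1 L)) → ℝ) (x y : TorusSite 1 L) :
    ‖(hubbardTorusWith 1 L t U μ + densityInteraction W).thermalCorr β
        (siteSpinPlus x) (siteSpinPlus y)ᴴ‖ ≤
      Real.exp 4 * Real.exp (-(torusDist x y : ℝ)) := by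
  have h := norm_thermalCorr_siteSpinPlus_ring_densityInteraction_le_exp L t U μ β 1 hβ
    zero_le_one W x y
  have hcosh : Real.cosh 1 - 1 ≤ 1 := by
    have := cosh_sub_one_le_sq (s := (1 : ℝ)) (by norm_num)
    simpa using this
  have hb : 0 ≤ β * |t| := mul_nonneg hβ (abs_nonneg t)
  rw [mul_one] at h
  refine h.trans (mul_le_mul_of_nonneg_left (Real.exp_le_exp.2 ?_) (Real.exp_pos _).le)
  have hr0 : (0 : ℝ) ≤ torusDist x y := Nat.cast_nonneg _
  have hm : (1 : ℝ) ≤ 2 * 1 - 4 * (β * |t|) * (Real.cosh 1 - 1) := by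
    nlinarith [mul_le_mul_of_nonneg_left hcosh (by positivity : (0 : ℝ) ≤ 4 * (β * |t|))]
  nlinarith

end RingClass

/-! ### The square lattice: the sharp magnetic power law, uniformly over the class -/

section SquareClass

/-- **Two dimensions, transverse spin correlation of `H(t,U) - μN + V({n})`, sharp power law**:
on `(ℤ/Lℤ)²`, for every real `W`, all real `t, U, μ`, `β ≥ 0`, every `q ≥ 0` with
`f := 4q - 4πβ|t|q² ≥ 0`, and all `x, y`:
`|⟨S⁺_x S⁻_y⟩_{β,L; H+V}| ≤ K(q) 5^f (dist(x,y)+1)^{-f}`, `K(q) = exp[2β|t|(2πq² + 76q² + 544q⁴e^{2q²})]`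
— uniformly in `L` and in `V`; at `q = 1/(2πβ|t|)` the exponent is `T/(π|t|)` (the McBryan–Spencer
value with the printed hopping norm). Euclidean dipole profile via the model-independent
`le_rpow_euclid_of_apriori_flat`. Koma–Tasaki, PRL 68 (1992) 3248, eq. (1), Theorem eq. (4),
eq. (13). [cite: KomaTasakiPRL1992, Theorem eq. (4) and eq. (13)] -/
theorem norm_thermalCorr_siteSpinPlus_densityInteraction_le_rpow_euclid (L : ℕ) [NeZero L]
    (t U μ β q : ℝ) (hβ : 0 ≤ β) (hq : 0 ≤ q)
    (hf : 0 ≤ 4 * q - 4 * Real.pi * (β * |t|) * q ^ 2)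
    (W : Finset (Orb (FermionTorus 2 L)) → ℝ) (x y : TorusSite 2 L) :
    ‖(hubbardTorusWith 2 L t U μ + densityInteraction W).thermalCorr β
        (siteSpinPlus x) (siteSpinPlus y)ᴴ‖ ≤
      Real.exp (2 * (β * |t|) *
          (2 * Real.pi * q ^ 2 + 76 * q ^ 2 + 544 * q ^ 4 * Real.exp (2 * q ^ 2))) *
        ((5 : ℝ) ^ (4 * q - 4 * Real.pi * (β * |t|) * q ^ 2) *
          ((torusDist x y : ℝ) + 1) ^ (-(4 * q - 4 * Real.pi * (β * |t|) * q ^ 2))) :=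
  le_rpow_euclid_of_apriori_flat L (β * |t|) 2 q _ _ (mul_nonneg hβ (abs_nonneg t)) hq x y
    (fun φ _ _ => (norm_thermalCorr_siteSpinPlus_densityInteraction_le_sharp t U μ β hβ W φ
      x y).trans_eq (by rw [mul_assoc]))
    (by ring) hf

/-- **The sharp magnetic exponent at its optimal charge, class version**: for `β|t| > 0` and
`q = 1/(2πβ|t|)`, `f = 1/(πβ|t|) = T/(π|t|)`: `|⟨S⁺_x S⁻_y⟩_{β,L; H+V}| ≤ K · 5^f (dist+1)^{-f}`
with `K = exp[2β|t|(2πq² + 76q² + 544q⁴e^{2q²})]`, for every real `W`.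
[cite: KomaTasakiPRL1992, Theorem eq. (4) and eq. (13)] -/
theorem norm_thermalCorr_siteSpinPlus_densityInteraction_le_rpow_sharp (L : ℕ) [NeZero L]
    (t U μ β : ℝ) (hβ : 0 ≤ β) (hb : 0 < β * |t|)
    (W : Finset (Orb (FermionTorus 2 L)) → ℝ) (x y : TorusSite 2 L) :
    ‖(hubbardTorusWith 2 L t U μ + densityInteraction W).thermalCorr β
        (siteSpinPlus x) (siteSpinPlus y)ᴴ‖ ≤
      Real.exp (2 * (β * |t|) *
          (2 * Real.pi * (1 / (2 * Real.pi * (β * |t|))) ^ 2 +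
            76 * (1 / (2 * Real.pi * (β * |t|))) ^ 2 +
            544 * (1 / (2 * Real.pi * (β * |t|))) ^ 4 *
              Real.exp (2 * (1 / (2 * Real.pi * (β * |t|))) ^ 2))) *
        ((5 : ℝ) ^ (1 / (Real.pi * (β * |t|))) *
          ((torusDist x y : ℝ) + 1) ^ (-(1 / (Real.pi * (β * |t|))))) := by
  have hπ := Real.pi_pos
  set q : ℝ := 1 / (2 * Real.pi * (β * |t|)) with hq
  have hq0 : 0 ≤ q := by positivity
  have hfval : 4 * q - 4 * Real.pi * (β * |t|) * q ^ 2 = 1 / (Real.pi * (β * |t|)) := by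
    rw [hq]
    field_simp
    ring
  have h := norm_thermalCorr_siteSpinPlus_densityInteraction_le_rpow_euclid L t U μ β q hβ hq0
    (by rw [hfval]; positivity) W x y
  rw [hfval] at h
  exact h

end SquareClass

end Literature.MathematicalPhysics.QuantumLattice

end
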